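import Summits.CriticalPhenomena.PercolationContinuityZ3.Theorems.PercNearOneGluingAdditiveGluingCondAD
import HarnessLib

/-!
# Crux `PercNearOneGluing.AdditiveGluing` (stmt-CriticalPhenomena-4576) — the Ahlswede–Daykin / Harris
# four-event inequality for three-terminal connectivity events CONDITIONED ON THE ISOLATION of vertex sets
# — part II: measure statements (`condAD_two_sets`, `condHarris_isolated`, `condHarris_isolated_mixed`)

Helper file (task `png-dp-al5`, gen 3; `--supports stmt-CriticalPhenomena-4576`); generalises
`…SepCapture.lean` (whose `sepCapture_two_sets` is the instance `A₁ = {o↔a}`, `D₁ = {o↮b, a↮b}`,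
`A₂ = {o↔b}`, `D₂ = {o↮a, a↮b}` of the theorem below).

Bond percolation with arbitrary edge probabilities on a finite vertex type (`μ = prodBernoulli w`), three
vertices `o, a, b` ("terminals").  A TERMINAL EVENT is an event of the form
`{ω | P (o↔a) (o↔b) (a↔b)}` for a predicate `P` of the three connection relations among the terminals; it is
increasing if `P` is monotone in each argument, decreasing if antitone (hypotheses spelled out; no
definition is introduced).  For a vertex set `W` write
`I_W = {o,a,b} ↮ W = {∀ x ∈ W, o↮x} ∩ {∀ x ∈ W, a↮x} ∩ {∀ x ∈ W, b↮x}`.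

**Theorem (`condAD_two_sets`).**  For increasing terminal events `A₁, A₂`, decreasing terminal events
`D₁, D₂` and vertex sets `S, T`:

  `μ(A₁ ∩ D₁ ∩ I_S) · μ(A₂ ∩ D₂ ∩ I_T) ≤ μ(A₁ ∩ A₂ ∩ I_{S∩T}) · μ(D₁ ∩ D₂ ∩ I_{S∪T})`.

For `S = T = ∅` this is the Ahlswede–Daykin four-event inequality (Harris–FKG in product form); the point is
that it SURVIVES CONDITIONING ON THE ISOLATION EVENTS `I_S, I_T` (decreasing events, for which no FKG
structure is available in general), with the intersection/union bookkeeping of van den Berg–Kahn 2001 /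
BHK 2006 Thm. 1.1.  Corollaries (`S = T = W`): given `I_W`, increasing terminal events are positively
correlated (`condHarris_isolated`), and the separated-capture inequality
`P(oa|b|c)·P(ob|a|c) ≤ P(oab|c)·P(o|a|b|c)` of `…SepCapture.lean`.  The terminal events are NOT measurable
with respect to the cluster of one vertex (or two), so this is not a case of BHK's Thms. 1.1–1.5; and given
`I_W` the join of two configurations does not preserve `I_W`, so it is not a case of Ahlswede–Daykin either.

## Proof

Verbatim the induction of `…SepCapture.lean` / `BHK2006.core` ([VandenbergKahn2001, proof of Thm. 1.2];
[VandenbergHaggstromKahn2005, Thm. 1.1, pp. 3–5]): strong induction on the vertex set `U` of the restricted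
model `G[U]`; if `Z := S ∩ T ∩ U = ∅`, the four functions theorem on the configuration lattice (the join of
`α ∈ A₁ ∩ D₁ ∩ I_S` and `β ∈ A₂ ∩ D₂ ∩ I_T` lies in `A₁ ∩ A₂`, the meet in `D₁ ∩ D₂ ∩ I_{S∪T}`, by the
monotonicity of the predicates and of restricted reachability); otherwise condition on the set `R` of
vertices of `U ∖ Z` with an open edge to `Z`: on `I_Z` every terminal event of `G[U]` is the same terminal
event of `G[U ∖ Z]` and `I_W` becomes `I_{(W∖Z) ∪ R}` (BHK's identity (6) for the three sources, file
`…SepCaptureAux`), the law of `R` is a product weight, and Ahlswede–Daykin over `R` with the induction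
hypothesis for `G[U ∖ Z]` closes the step.

## References
* J. van den Berg, J. Kahn, Ann. Probab. 29 (2001) 123–126, Thm. 1.2 and its proof. [VandenbergKahn2001]
* J. van den Berg, O. Häggström, J. Kahn, RSA 29 (2006) 417–435, Thm. 1.1 (pp. 3–5). [VandenbergHaggstromKahn2005]
* R. Ahlswede, D. E. Daykin (1978) (Mathlib `four_functions_theorem_univ`).
-/

noncomputable section

open MeasureTheory
open Literature.Probability.LatticeModels (prodBernoulli)
open Literature.Probability.Percolation
open Literature.Probability.Percolation.BHK2006
open DecisionTree (ind ind_of_mem ind_of_not_mem ind_nonneg)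

namespace Summit.CriticalPhenomena.PercolationContinuityZ3.Theorems

open scoped Classical

variable {V : Type*}

/-! Local notations (no new definitions): `rR[U, x, y]` = `{x ↔ y in G[U]}`; `rAV[U, o, a, b, W]` = the
isolation event `{o,a,b} ↮ W` in `G[U]`; `rEV[U, o, a, b, P]` = the terminal event of the predicate `P` in
`G[U]`. -/
local notation3 "rR[" U ", " x ", " y "]" =>
  {ω : Set (Sym2 V) | (openGraph (ω ∩ edgesIn U)).Reachable x y}
local notation3 "rAV[" U ", " o ", " a ", " b ", " W "]" => rD U o W ∩ rD U a W ∩ rD U b W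
local notation3 "rEV[" U ", " o ", " a ", " b ", " P "]" =>
  {ω : Set (Sym2 V) | (P : Prop → Prop → Prop → Prop) ((openGraph (ω ∩ edgesIn U)).Reachable o a)
    ((openGraph (ω ∩ edgesIn U)).Reachable o b) ((openGraph (ω ∩ edgesIn U)).Reachable a b)}

/-! Monotonicity of a terminal predicate `P : Prop → Prop → Prop → Prop` ("increasing terminal event") is the
hypothesis `∀ p p' q q' r r', (p → p') → (q → q') → (r → r') → P p q r → P p' q' r'`; antitonicity
("decreasing") has the implications reversed.  (Spelled out; no definition is introduced.) -/

/-! ### Measure statements (`U = univ`) -/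

section Measure

variable [Fintype V]

/-- **Conditional Ahlswede–Daykin for terminal events, two isolation sets.**  For increasing terminal
predicates `A₁, A₂`, decreasing `D₁, D₂`, vertex sets `S, T`, and `μ = prodBernoulli w`:
`μ(A₁ ∩ D₁ ∩ I_S) · μ(A₂ ∩ D₂ ∩ I_T) ≤ μ(A₁ ∩ A₂ ∩ I_{S∩T}) · μ(D₁ ∩ D₂ ∩ I_{S∪T})`, where a predicate
`P` stands for the event `{ω | P (o↔a) (o↔b) (a↔b)}` and `I_W = {∀x∈W, o↮x} ∩ {∀x∈W, a↮x} ∩ {∀x∈W, b↮x}`.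
[cite: VandenbergKahn2001, Thm. 1.2 (pp. 124–126) — method; derived in this file] -/
theorem condAD_two_sets (w : Sym2 V → unitInterval) (o a b : V) (A₁ A₂ D₁ D₂ : Prop → Prop → Prop → Prop)
    (hA₁ : ∀ (p p' q q' r r' : Prop), (p → p') → (q → q') → (r → r') → A₁ p q r → A₁ p' q' r')
    (hA₂ : ∀ (p p' q q' r r' : Prop), (p → p') → (q → q') → (r → r') → A₂ p q r → A₂ p' q' r')
    (hD₁ : ∀ (p p' q q' r r' : Prop), (p' → p) → (q' → q) → (r' → r) → D₁ p q r → D₁ p' q' r')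
    (hD₂ : ∀ (p p' q q' r r' : Prop), (p' → p) → (q' → q) → (r' → r) → D₂ p q r → D₂ p' q' r')
    (S T : Set V) :
    (prodBernoulli w).real
        ({ω | A₁ ((openGraph ω).Reachable o a) ((openGraph ω).Reachable o b) ((openGraph ω).Reachable a b)} ∩
          {ω | D₁ ((openGraph ω).Reachable o a) ((openGraph ω).Reachable o b) ((openGraph ω).Reachable a b)} ∩
          ({ω | ∀ x ∈ S, ω ∉ openConn o x} ∩ {ω | ∀ x ∈ S, ω ∉ openConn a x} ∩
            {ω | ∀ x ∈ S, ω ∉ openConn b x})) *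
      (prodBernoulli w).real
        ({ω | A₂ ((openGraph ω).Reachable o a) ((openGraph ω).Reachable o b) ((openGraph ω).Reachable a b)} ∩
          {ω | D₂ ((openGraph ω).Reachable o a) ((openGraph ω).Reachable o b) ((openGraph ω).Reachable a b)} ∩
          ({ω | ∀ x ∈ T, ω ∉ openConn o x} ∩ {ω | ∀ x ∈ T, ω ∉ openConn a x} ∩
            {ω | ∀ x ∈ T, ω ∉ openConn b x})) ≤
    (prodBernoulli w).real
        ({ω | A₁ ((openGraph ω).Reachable o a) ((openGraph ω).Reachable o b) ((openGraph ω).Reachable a b)} ∩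
          {ω | A₂ ((openGraph ω).Reachable o a) ((openGraph ω).Reachable o b) ((openGraph ω).Reachable a b)} ∩
          ({ω | ∀ x ∈ S ∩ T, ω ∉ openConn o x} ∩ {ω | ∀ x ∈ S ∩ T, ω ∉ openConn a x} ∩
            {ω | ∀ x ∈ S ∩ T, ω ∉ openConn b x})) *
      (prodBernoulli w).real
        ({ω | D₁ ((openGraph ω).Reachable o a) ((openGraph ω).Reachable o b) ((openGraph ω).Reachable a b)} ∩
          {ω | D₂ ((openGraph ω).Reachable o a) ((openGraph ω).Reachable o b) ((openGraph ω).Reachable a b)} ∩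
          ({ω | ∀ x ∈ S ∪ T, ω ∉ openConn o x} ∩ {ω | ∀ x ∈ S ∪ T, ω ∉ openConn a x} ∩
            {ω | ∀ x ∈ S ∪ T, ω ∉ openConn b x})) := by
  set w' : Sym2 V → ℝ := fun e => (w e : ℝ) with hw'
  have hw0 : ∀ e, 0 ≤ w' e := fun e => (w e).2.1
  have hw1 : ∀ e, w' e ≤ 1 := fun e => (w e).2.2
  have hm : ∑ ω, weight w' ω = 1 := by
    have h1 := integral_prodBernoulli_eq_sum w fun _ => (1 : ℝ)
    simp only [integral_const, probReal_univ, smul_eq_mul, mul_one] at h1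
    exact h1.symm
  have hE : ∀ ω : Set (Sym2 V), ω ∩ edgesIn (Finset.univ : Finset V) = ω := fun ω => by
    ext e
    simp only [Set.mem_inter_iff, edgesIn, Set.mem_setOf_eq, Finset.mem_univ, imp_true_iff, and_true]
  have hDD : ∀ (s : V) (Z : Set V),
      rD (Finset.univ : Finset V) s Z = {ω : BondConfig V | ∀ x ∈ Z, ω ∉ openConn s x} := by
    intro s Z; ext ω; simp only [rD, hE, Set.mem_setOf_eq]; rfl
  have key := condAD_core w' hw0 hw1 hm Finset.univ o a b A₁ A₂ D₁ D₂ hA₁ hA₂ hD₁ hD₂ S T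
    (by simp) (by simp)
  simp only [hE, hDD] at key
  rw [TwoAvoidanceSets.real_eq_sum_ind, TwoAvoidanceSets.real_eq_sum_ind,
    TwoAvoidanceSets.real_eq_sum_ind, TwoAvoidanceSets.real_eq_sum_ind]
  exact key

/-- **Conditional Harris given isolation (increasing events).**  Given the isolation event
`I_W = {o,a,b} ↮ W`, two increasing terminal events are positively correlated:
`μ(A ∩ I_W) · μ(B ∩ I_W) ≤ μ(A ∩ B ∩ I_W) · μ(I_W)`.
[cite: VandenbergKahn2001, Thm. 1.2 (pp. 124–126) — method; derived in this file] -/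
theorem condHarris_isolated (w : Sym2 V → unitInterval) (o a b : V) (A B : Prop → Prop → Prop → Prop)
    (hA : ∀ (p p' q q' r r' : Prop), (p → p') → (q → q') → (r → r') → A p q r → A p' q' r')
    (hB : ∀ (p p' q q' r r' : Prop), (p → p') → (q → q') → (r → r') → B p q r → B p' q' r')
    (W : Set V) :
    (prodBernoulli w).real
        ({ω | A ((openGraph ω).Reachable o a) ((openGraph ω).Reachable o b) ((openGraph ω).Reachable a b)} ∩
          ({ω | ∀ x ∈ W, ω ∉ openConn o x} ∩ {ω | ∀ x ∈ W, ω ∉ openConn a x} ∩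
            {ω | ∀ x ∈ W, ω ∉ openConn b x})) *
      (prodBernoulli w).real
        ({ω | B ((openGraph ω).Reachable o a) ((openGraph ω).Reachable o b) ((openGraph ω).Reachable a b)} ∩
          ({ω | ∀ x ∈ W, ω ∉ openConn o x} ∩ {ω | ∀ x ∈ W, ω ∉ openConn a x} ∩
            {ω | ∀ x ∈ W, ω ∉ openConn b x})) ≤
    (prodBernoulli w).real
        ({ω | A ((openGraph ω).Reachable o a) ((openGraph ω).Reachable o b) ((openGraph ω).Reachable a b)} ∩
          {ω | B ((openGraph ω).Reachable o a) ((openGraph ω).Reachable o b) ((openGraph ω).Reachable a b)} ∩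
          ({ω | ∀ x ∈ W, ω ∉ openConn o x} ∩ {ω | ∀ x ∈ W, ω ∉ openConn a x} ∩
            {ω | ∀ x ∈ W, ω ∉ openConn b x})) *
      (prodBernoulli w).real
        ({ω | ∀ x ∈ W, ω ∉ openConn o x} ∩ {ω | ∀ x ∈ W, ω ∉ openConn a x} ∩
          {ω | ∀ x ∈ W, ω ∉ openConn b x}) := by
  have key := condAD_two_sets w o a b A B (fun _ _ _ => True) (fun _ _ _ => True) hA hB
    (fun _ _ _ _ _ _ _ _ _ _ => trivial) (fun _ _ _ _ _ _ _ _ _ _ => trivial) W W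
  simp only [Set.setOf_true, Set.inter_univ, Set.inter_self, Set.union_self, Set.univ_inter] at key
  exact key

/-- **Conditional Harris given isolation (mixed signs).**  Given `I_W = {o,a,b} ↮ W`, an increasing and a
decreasing terminal event are negatively correlated: `μ(A ∩ D ∩ I_W) · μ(I_W) ≤ μ(A ∩ I_W) · μ(D ∩ I_W)`.
[cite: VandenbergKahn2001, Thm. 1.2 (pp. 124–126) — method; derived in this file] -/
theorem condHarris_isolated_mixed (w : Sym2 V → unitInterval) (o a b : V)
    (A D : Prop → Prop → Prop → Prop)
    (hA : ∀ (p p' q q' r r' : Prop), (p → p') → (q → q') → (r → r') → A p q r → A p' q' r')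
    (hD : ∀ (p p' q q' r r' : Prop), (p' → p) → (q' → q) → (r' → r) → D p q r → D p' q' r')
    (W : Set V) :
    (prodBernoulli w).real
        ({ω | A ((openGraph ω).Reachable o a) ((openGraph ω).Reachable o b) ((openGraph ω).Reachable a b)} ∩
          {ω | D ((openGraph ω).Reachable o a) ((openGraph ω).Reachable o b) ((openGraph ω).Reachable a b)} ∩
          ({ω | ∀ x ∈ W, ω ∉ openConn o x} ∩ {ω | ∀ x ∈ W, ω ∉ openConn a x} ∩
            {ω | ∀ x ∈ W, ω ∉ openConn b x})) *
      (prodBernoulli w).real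
        ({ω | ∀ x ∈ W, ω ∉ openConn o x} ∩ {ω | ∀ x ∈ W, ω ∉ openConn a x} ∩
          {ω | ∀ x ∈ W, ω ∉ openConn b x}) ≤
    (prodBernoulli w).real
        ({ω | A ((openGraph ω).Reachable o a) ((openGraph ω).Reachable o b) ((openGraph ω).Reachable a b)} ∩
          ({ω | ∀ x ∈ W, ω ∉ openConn o x} ∩ {ω | ∀ x ∈ W, ω ∉ openConn a x} ∩
            {ω | ∀ x ∈ W, ω ∉ openConn b x})) *
      (prodBernoulli w).real
        ({ω | D ((openGraph ω).Reachable o a) ((openGraph ω).Reachable o b) ((openGraph ω).Reachable a b)} ∩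
          ({ω | ∀ x ∈ W, ω ∉ openConn o x} ∩ {ω | ∀ x ∈ W, ω ∉ openConn a x} ∩
            {ω | ∀ x ∈ W, ω ∉ openConn b x})) := by
  have key := condAD_two_sets w o a b A (fun _ _ _ => True) D (fun _ _ _ => True) hA
    (fun _ _ _ _ _ _ _ _ _ _ => trivial) hD (fun _ _ _ _ _ _ _ _ _ _ => trivial) W W
  simp only [Set.setOf_true, Set.inter_univ, Set.inter_self, Set.union_self, Set.univ_inter] at key
  exact key

end Measure

end Summit.CriticalPhenomena.PercolationContinuityZ3.Theorems

end
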